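import Literature.NumberTheory.Transcendental.TwoVarJets
import Literature.NumberTheory.Transcendental.ThetaAnalytic
import Literature.NumberTheory.Transcendental.PkappaThetaGrowth
import Literature.NumberTheory.Transcendental.BakerLogarithmsAnalytic
import Mathlib.Analysis.Complex.Liouville
import Mathlib.Analysis.Calculus.IteratedDeriv.Lemmas
import Literature.NumberTheory.Transcendental.NesterenkoEliminationNorms
import HarnessLib

/-!
# The extrapolation functions of Baker's method on `M_κ`

Topic: `Literature/NumberTheory/Transcendental`. Plan item W4/S5(d) of the unit
`provefact-Literature.NumberTheory.Transcendental.H-b596640137`. For a form `P`, a base direction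
`v` and a direction `x` of the analytic subgroup `𝔟`, the **extrapolation function**
`φ_{x,k}(z) = d^k/dξ^k F_P(z·v + ξ·x)|_{ξ=0}` (`GaGmE.Std.extrapFun`) is the one-variable
entire function to which the Schwarz-lemma-with-multiplicities of Baker's method
(`Baker1975.Analytic.norm_le_of_analyticOrderAt`, `BakerLogarithmsAnalytic.lean`) is applied.
PROVED here:

* `extrapFun_eq` — `φ_{x,k}(z) = D^kF_P(z·v)(x, …, x)` (`DirectionalJets.lean`), hence
  `differentiable_extrapFun` — `φ_{x,k}` is entire (`ThetaAnalytic.lean`);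
* `iteratedDeriv_extrapFun_eq_zero`, `le_analyticOrderAt_extrapFun` — **zeros**: if `v, x ∈ 𝔟`
  and `F_P` vanishes to order `≥ T` along `𝔟` at `s·v`, then `φ_{x,k}` vanishes to order
  `≥ T - k` at `z = s` (`TwoVarJets.lean`: separated jets are mixed derivatives);
* `extrapFun_eq_zero_iff`-type link back: `φ_{x,k}(s) = 0` for all `x ∈ 𝔟`, `k < T'` is literally
  `VanishesAlong 𝔟 F_P (s·v) T'` (`vanishesAlong_iff_extrapFun`);
* `norm_thetaEval_le` — **growth** `|F_P(w)| ≤ ‖P‖₁ · e^{D·C(1 + ‖w‖²)}` for forms of degree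
  `≤ D` (`PkappaThetaGrowth.lean`; `‖P‖₁ = Nesterenko.l1Norm P`), and `norm_extrapFun_le` — the
  Cauchy estimate `|φ_{x,k}(z)| ≤ k! · ‖P‖₁ · e^{D·C(1 + (‖z‖‖v‖ + ‖x‖)²)}`.

Delta to the printed source: Baker–Wüstholz (p. 118) take `Ψ = Φ^*(LP)` with `L` a MONOMIAL in
the operators `L₁, …, L_d` of degree `≤ T/2` (mixed derivatives, zeros of order `≥ [T/2] + 1`);
here, consistently with the tree's `VanishesAlong` convention, we use the pure `k`-th derivative
along a single direction `x ∈ 𝔟` (the polarised variant, `DirectionalJets.lean`) with the sharp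
order `T - k`.

## References

* A. Baker, G. Wüstholz, *Logarithmic Forms and Diophantine Geometry*, CUP 2007, §6.8 (p. 119).
* A. Baker, *Transcendental Number Theory*, CUP 1975, Ch. 2, Lemmas 4–5.
-/

noncomputable section

open Complex Metric Set
open scoped ContDiff

namespace Literature.NumberTheory.Transcendental

namespace GaGmE

namespace Std

variable {β γ δ : Type} [Fintype β] [Fintype γ] [Fintype δ] [DecidableEq γ]
variable (L : PeriodPair) (κM : δ → γ → Kbar)

/-! ### The extrapolation functions -/

/-- **The extrapolation function** `φ_{x,k}(z) = d^k/dξ^k F_P(z·v + ξ·x)|_{ξ=0}` (the polarised,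
single-direction variant of `Ψ = Φ^*(LP)` of the source, see the module docstring).
[cite: BakerWustholz2007, §6.8 (pp. 118–119)] -/
def extrapFun (P : MvPolynomial (Option β × ThetaIdx γ δ) ℂ) (v x : β ⊕ (γ ⊕ δ) → ℂ) (k : ℕ)
    (z : ℂ) : ℂ :=
  iteratedDeriv k (fun ξ : ℂ => thetaEval L κM P (z • v + ξ • x)) 0

/-- `φ_{x,k}(z) = D^kF_P(z·v)(x, …, x)`. [folklore] -/
theorem extrapFun_eq (P : MvPolynomial (Option β × ThetaIdx γ δ) ℂ) (v x : β ⊕ (γ ⊕ δ) → ℂ)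
    (k : ℕ) (z : ℂ) :
    extrapFun L κM P v x k z = iteratedFDeriv ℂ k (thetaEval L κM P) (z • v) fun _ => x :=
  iteratedDeriv_line_eq_iteratedFDeriv (contDiff_thetaEval L κM P) (z • v) x le_top

/-- **`φ_{x,k}` is entire.** [folklore] -/
theorem differentiable_extrapFun (P : MvPolynomial (Option β × ThetaIdx γ δ) ℂ)
    (v x : β ⊕ (γ ⊕ δ) → ℂ) (k : ℕ) : Differentiable ℂ (extrapFun L κM P v x k) := by
  have e : extrapFun L κM P v x k =
      (fun y => iteratedFDeriv ℂ k (thetaEval L κM P) y fun _ => x) ∘ fun z : ℂ => z • v := by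
    funext z; exact extrapFun_eq L κM P v x k z
  rw [e]
  have hg : ContDiff ℂ ω (fun y => iteratedFDeriv ℂ k (thetaEval L κM P) y fun _ : Fin k => x) :=
    (ContinuousMultilinearMap.apply ℂ (fun _ : Fin k => β ⊕ (γ ⊕ δ) → ℂ) ℂ (fun _ => x)).contDiff.comp
      ((contDiff_thetaEval L κM P).iteratedFDeriv_right le_top)
  exact (hg.differentiable (by simp)).comp (differentiable_id.smul_const v)

omit [Fintype β] [Fintype δ] in
/-- `φ_{x,k}(s) = d^k/dξ^k F_P(s·v + ξx)|₀`: the vanishing of `φ_{x,k}(s)` for all `x ∈ 𝔟`,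
`k < T'` is the vanishing of `F_P` to order `≥ T'` along `𝔟` at `s·v`. [folklore] -/
theorem vanishesAlong_iff_extrapFun (P : MvPolynomial (Option β × ThetaIdx γ δ) ℂ)
    (𝔟 : Submodule ℂ (β ⊕ (γ ⊕ δ) → ℂ)) (v : β ⊕ (γ ⊕ δ) → ℂ) (s : ℂ) (T' : ℕ) :
    VanishesAlong 𝔟 (thetaEval L κM P) (s • v) T' ↔ ∀ x ∈ 𝔟, ∀ k < T', extrapFun L κM P v x k s = 0 :=
  Iff.rfl

/-! ### Zeros -/

/-- **Zeros of the extrapolation functions.** If `v, x ∈ 𝔟` and `F_P` vanishes to order `≥ T`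
along `𝔟` at `s·v`, then `φ_{x,k}^{(j)}(s) = 0` for `j + k < T`. [cite: BakerWustholz2007, §6.8 (p. 119)] -/
theorem iteratedDeriv_extrapFun_eq_zero (P : MvPolynomial (Option β × ThetaIdx γ δ) ℂ)
    {𝔟 : Submodule ℂ (β ⊕ (γ ⊕ δ) → ℂ)} {v x : β ⊕ (γ ⊕ δ) → ℂ} (hv : v ∈ 𝔟) (hx : x ∈ 𝔟)
    {s : ℂ} {T : ℕ} (hvan : VanishesAlong 𝔟 (thetaEval L κM P) (s • v) T) {j k : ℕ}
    (hjk : j + k < T) : iteratedDeriv j (extrapFun L κM P v x k) s = 0 := by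
  have e1 : iteratedDeriv j (extrapFun L κM P v x k) s =
      iteratedDeriv j (fun z => extrapFun L κM P v x k (s + z)) 0 := by
    rw [iteratedDeriv_comp_const_add]; simp
  have e2 : (fun z => extrapFun L κM P v x k (s + z)) =
      fun z : ℂ => iteratedDeriv k (fun ξ : ℂ => thetaEval L κM P (s • v + z • v + ξ • x)) 0 := by
    funext z
    simp only [extrapFun, add_smul]
  rw [e1, e2]
  exact iteratedDeriv_iteratedDeriv_line_eq_zero (contDiff_thetaEval L κM P) 𝔟 (s • v) T hvan hv hx hjk

/-- The order of `φ_{x,k}` at `s` is at least `T - k`. [folklore] -/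
theorem le_analyticOrderAt_extrapFun (P : MvPolynomial (Option β × ThetaIdx γ δ) ℂ)
    {𝔟 : Submodule ℂ (β ⊕ (γ ⊕ δ) → ℂ)} {v x : β ⊕ (γ ⊕ δ) → ℂ} (hv : v ∈ 𝔟) (hx : x ∈ 𝔟)
    {s : ℂ} {T : ℕ} (hvan : VanishesAlong 𝔟 (thetaEval L κM P) (s • v) T) (k : ℕ) :
    ((T - k : ℕ) : ℕ∞) ≤ analyticOrderAt (extrapFun L κM P v x k) s :=
  Baker1975.Analytic.le_analyticOrderAt_of_iteratedDeriv_eq_zero (differentiable_extrapFun L κM P v x k)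
    fun j hj => iteratedDeriv_extrapFun_eq_zero L κM P hv hx hvan (by omega)

/-! ### Growth -/

/-- **Growth of the forms.** With the constant `C` of `exists_norm_theta_le`: for `P` of total
degree `≤ D`, `|F_P(w)| ≤ ‖P‖₁ · e^{C(1 + ‖w‖²)}^D`. [folklore] -/
theorem norm_thetaEval_le {C : ℝ} (hC0 : 0 ≤ C)
    (hC : ∀ (J : Option β × ThetaIdx γ δ) (w : β ⊕ (γ ⊕ δ) → ℂ), ‖theta L κM J w‖ ≤ Real.exp (C * (1 + ‖w‖ ^ 2)))
    {P : MvPolynomial (Option β × ThetaIdx γ δ) ℂ} {D : ℕ} (hP : P.totalDegree ≤ D) (w : β ⊕ (γ ⊕ δ) → ℂ) :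
    ‖thetaEval L κM P w‖ ≤ Nesterenko.l1Norm P * Real.exp (C * (1 + ‖w‖ ^ 2)) ^ D := by
  set M := Real.exp (C * (1 + ‖w‖ ^ 2)) with hM
  have hM1 : 1 ≤ M := Real.one_le_exp (by positivity)
  have hmono : ∀ ν ∈ P.support, ‖(ν.prod fun J e => theta L κM J w ^ e)‖ ≤ M ^ D := by
    intro ν hν
    rw [Finsupp.prod, norm_prod]
    have hdeg : ∑ J ∈ ν.support, ν J ≤ D := by
      have h1 : (ν.sum fun _ e => e) ≤ P.totalDegree := MvPolynomial.le_totalDegree hν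
      rw [Finsupp.sum] at h1
      exact h1.trans hP
    calc ∏ J ∈ ν.support, ‖theta L κM J w ^ ν J‖ ≤ ∏ J ∈ ν.support, M ^ ν J := by
          refine Finset.prod_le_prod (fun J _ => norm_nonneg _) fun J _ => ?_
          rw [norm_pow]
          exact pow_le_pow_left₀ (norm_nonneg _) (hC J w) _
      _ = M ^ ∑ J ∈ ν.support, ν J := Finset.prod_pow_eq_pow_sum _ _ _
      _ ≤ M ^ D := pow_le_pow_right₀ hM1 hdeg
  unfold thetaEval Nesterenko.l1Norm
  rw [MvPolynomial.eval_eq, Finset.sum_mul]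
  refine (norm_sum_le _ _).trans (Finset.sum_le_sum fun ν hν => ?_)
  rw [norm_mul]
  exact mul_le_mul_of_nonneg_left (by simpa [Finsupp.prod] using hmono ν hν) (norm_nonneg _)

/-- **Growth of the extrapolation functions** (Cauchy's estimate on the unit circle in `ξ`):
`|φ_{x,k}(z)| ≤ k! · ‖P‖₁ · e^{C(1 + (‖z‖‖v‖ + ‖x‖)²)·D}`. [cite: Baker1975, Ch. 2 Lemma 4] -/
theorem norm_extrapFun_le {C : ℝ} (hC0 : 0 ≤ C)
    (hC : ∀ (J : Option β × ThetaIdx γ δ) (w : β ⊕ (γ ⊕ δ) → ℂ), ‖theta L κM J w‖ ≤ Real.exp (C * (1 + ‖w‖ ^ 2)))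
    {P : MvPolynomial (Option β × ThetaIdx γ δ) ℂ} {D : ℕ} (hP : P.totalDegree ≤ D)
    (v x : β ⊕ (γ ⊕ δ) → ℂ) (k : ℕ) (z : ℂ) :
    ‖extrapFun L κM P v x k z‖ ≤
      k.factorial * (Nesterenko.l1Norm P * Real.exp (C * (1 + (‖z‖ * ‖v‖ + ‖x‖) ^ 2)) ^ D) := by
  unfold extrapFun
  have hF : Differentiable ℂ (thetaEval L κM P) := fun w => (analyticAt_thetaEval L κM P w).differentiableAt
  have hdiff : Differentiable ℂ (fun ξ : ℂ => thetaEval L κM P (z • v + ξ • x)) :=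
    hF.comp ((differentiable_const _).add (differentiable_id.smul_const x))
  have hbound : ∀ ξ ∈ sphere (0 : ℂ) 1, ‖thetaEval L κM P (z • v + ξ • x)‖ ≤
      Nesterenko.l1Norm P * Real.exp (C * (1 + (‖z‖ * ‖v‖ + ‖x‖) ^ 2)) ^ D := by
    intro ξ hξ
    have hξ1 : ‖ξ‖ = 1 := by simpa using hξ
    refine (norm_thetaEval_le L κM hC0 hC hP _).trans ?_
    have hw : ‖z • v + ξ • x‖ ≤ ‖z‖ * ‖v‖ + ‖x‖ := by
      refine (norm_add_le _ _).trans (add_le_add ?_ ?_)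
      · exact (norm_smul_le z v)
      · rw [norm_smul, hξ1, one_mul]
    have hexp : Real.exp (C * (1 + ‖z • v + ξ • x‖ ^ 2)) ≤ Real.exp (C * (1 + (‖z‖ * ‖v‖ + ‖x‖) ^ 2)) := by
      refine Real.exp_le_exp.mpr (mul_le_mul_of_nonneg_left ?_ hC0)
      have := pow_le_pow_left₀ (norm_nonneg _) hw 2
      linarith
    exact mul_le_mul_of_nonneg_left (pow_le_pow_left₀ (Real.exp_nonneg _) hexp D) (Nesterenko.l1Norm_nonneg P)
  have h := Complex.norm_iteratedDeriv_le_of_forall_mem_sphere_norm_le (c := 0) (R := 1) k one_pos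
    hdiff.diffContOnCl hbound
  simpa using h

end Std

end GaGmE

end Literature.NumberTheory.Transcendental

end
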